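import Literature.Analysis.ODE.TransitionZoneGrowth
import HarnessLib

/-!
# The last Airy length before a simple turning point: a priori control from an affine coefficient bound

Topic `Literature/Analysis/ODE` (namespace `Literature.Analysis.ODE`), a packaging of
`TransitionZoneGrowth.norm_le_of_norm_coeff_le_sq` (growth factor `e^{max(KL,1)}` across a zone of
length `L` with `|q| ≤ K²`) for the END of a classically forbidden interval of the real equation
`y″ = q(x) y`: near a SIMPLE (non-degenerate) turning point `b` the coefficient is affinely small,
`|q(s)| ≤ c·(b − s) + e` on `[b − L, b]`, and on the natural (Airy) scale `c·L³ ≤ 1` (with the offset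
`e·L² ≤ 1`) one has `K²L² = cL³ + eL² ≤ 2`, so the solution and its derivative are controlled on the
whole layer by their values at `b` with an ABSOLUTE factor:

* `norm_le_of_affine_coeff` — `‖y s‖ ≤ (‖y b‖ + L‖y′ b‖)·e²` and `‖y′ s‖ ≤ (2‖y b‖/L + ‖y′ b‖)·e²`
  for `s ∈ [b − L, b]`.

This is how the far envelope of the infinity-normalised solution of Carter's equation (known on the
oscillatory side `[b₂, ∞)`) is continued `O(1)` e-foldings INTO the barrier, down to the depth where
the recessive structure takes over (`RecessiveDominance.lean`), with no Airy-function asymptotics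
(near-extremal Kerr programme, threshold cone, large `Λ`: the layer is thin, `L ≍ Λ^{-1/3}`, which is
what makes the affine bound available from a modulus of continuity of `q′`). Everything is proved.

## References
* P. Hartman, *Ordinary Differential Equations* (SIAM Classics 38, 2002), Ch. IV §1, Lemma 1.1.
  Key `Hartman2002`.
* F. W. J. Olver, *Asymptotics and Special Functions* (1974), Ch. 11 §§1–3 (turning points; the Airy
  scale `|q′|^{-1/3}`). Key `Olver1974`.
-/

noncomputable section

open Set

namespace Literature.Analysis.ODE

/-- **A priori bound on the last Airy length before a simple turning point.** Let `y″ = q y` (complex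
`y`, real `q`) on `[b − L, b]` (`L > 0`) with pointwise `HasDerivAt` data, and suppose
`|q(s)| ≤ c·(b − s) + e` there with `c, e ≥ 0`, `c·L³ ≤ 1`, `e·L² ≤ 1`. Then for every `s ∈ [b − L, b]`:
`‖y s‖ ≤ (‖y b‖ + L·‖y′ b‖)·e²` and `‖y′ s‖ ≤ (2‖y b‖/L + ‖y′ b‖)·e²`
(`norm_le_of_norm_coeff_le_sq` with `K² = cL + e ≤ 2/L²`, `max(KL, 1) ≤ 2`, `max(K, 1/L) ≤ 2/L`).
[cite: Hartman2002, Ch. IV §1, Lemma 1.1] -/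
theorem norm_le_of_affine_coeff {y y' : ℝ → ℂ} {q : ℝ → ℝ} {b L c e : ℝ} (hL : 0 < L)
    (hc : 0 ≤ c) (he : 0 ≤ e)
    (hy : ∀ s ∈ Icc (b - L) b, HasDerivAt y (y' s) s ∧ HasDerivAt y' ((q s : ℂ) * y s) s)
    (hq : ∀ s ∈ Icc (b - L) b, |q s| ≤ c * (b - s) + e) (hcL : c * L ^ 3 ≤ 1) (heL : e * L ^ 2 ≤ 1)
    {s : ℝ} (hs : s ∈ Icc (b - L) b) :
    ‖y s‖ ≤ (‖y b‖ + L * ‖y' b‖) * Real.exp 2 ∧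
      ‖y' s‖ ≤ (2 * ‖y b‖ / L + ‖y' b‖) * Real.exp 2 := by
  -- the zone `[α, α + L]` with `α = b − L`, coefficient bound `K² = cL + e`
  set α := b - L with hα
  have hbα : b = α + L := by rw [hα]; ring
  set K := Real.sqrt (c * L + e) with hK
  have hK0 : 0 ≤ K := Real.sqrt_nonneg _
  have hK2 : K ^ 2 = c * L + e := Real.sq_sqrt (by positivity)
  have hq' : ∀ x ∈ Icc α (α + L), ‖((q x : ℝ) : ℂ)‖ ≤ K ^ 2 := by
    intro x hx
    rw [← hbα] at hx
    rw [Complex.norm_real, Real.norm_eq_abs, hK2]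
    have h1 := hq x hx
    have h2 : c * (b - x) ≤ c * L := mul_le_mul_of_nonneg_left (by linarith [hx.1]) hc
    linarith
  have hy' : ∀ x ∈ Icc α (α + L), HasDerivAt y (y' x) x ∧ HasDerivAt y' (((q x : ℝ) : ℂ) * y x) x := by
    intro x hx; rw [← hbα] at hx; exact hy x hx
  have hb : b ∈ Icc α (α + L) := by rw [← hbα]; exact ⟨by linarith, le_rfl⟩
  have hs' : s ∈ Icc α (α + L) := by rw [← hbα]; exact hs
  obtain ⟨h1, h2⟩ := norm_le_of_norm_coeff_le_sq hL hK0 hy' hq' hb hs'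
  -- `KL ≤ 2` (indeed `(KL)² = cL³ + eL² ≤ 2 ≤ 4`) and `max(K, 1/L) ≤ 2/L`
  have hKL : K * L ≤ 2 := by
    have hsq : (K * L) ^ 2 ≤ 2 ^ 2 := by
      rw [mul_pow, hK2]; nlinarith
    exact (pow_le_pow_iff_left₀ (mul_nonneg hK0 hL.le) (by norm_num) two_ne_zero).1 hsq
  have hmax1 : max (K * L) 1 ≤ 2 := max_le hKL (by norm_num)
  have hexp : Real.exp (max (K * L) 1) ≤ Real.exp 2 := Real.exp_le_exp.2 hmax1
  have hmax2 : max K L⁻¹ ≤ 2 / L := by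
    refine max_le ?_ ?_
    · rw [le_div_iff₀ hL]; exact hKL
    · rw [inv_eq_one_div, div_le_div_iff_of_pos_right hL]; norm_num
  have hA0 : 0 ≤ ‖y b‖ + L * ‖y' b‖ := by positivity
  refine ⟨h1.trans (mul_le_mul_of_nonneg_left hexp hA0), h2.trans ?_⟩
  have hB : max K L⁻¹ * ‖y b‖ + ‖y' b‖ ≤ 2 * ‖y b‖ / L + ‖y' b‖ := by
    have := mul_le_mul_of_nonneg_right hmax2 (norm_nonneg (y b))
    rw [div_mul_eq_mul_div] at this
    linarith
  have hB0 : 0 ≤ max K L⁻¹ * ‖y b‖ + ‖y' b‖ :=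
    add_nonneg (mul_nonneg (hK0.trans (le_max_left _ _)) (norm_nonneg _)) (norm_nonneg _)
  exact mul_le_mul hB hexp (Real.exp_pos _).le (hB0.trans hB)

end Literature.Analysis.ODE

end
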